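import Mathlib
import Literature.Analysis.UnboundedOperators.ConjugateOperatorRegularity
import Literature.Analysis.UnboundedOperators.UnitaryRepSpectralMeasure
import Literature.Analysis.UnboundedOperators.FourierSpectrumCalculus
import Literature.Analysis.UnboundedOperators.StrongContRepresentationClosedProofs
import HarnessLib
import Summits.AtomisticToContinuum.FouriersLaw.Theorems.EmbeddedDrudeMourreMourreDissolutionLAPResolventCalculus

/-!
# Stub `stub_mourreThresholdLAP` — Mourre LAP infrastructure 6: the first resolvent identity

Item `stmt-AtomisticToContinuum-12594` (crux `MourreDissolution` of route `EmbeddedDrudeMourre`,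
sub-problem `FouriersLaw`), line `separable-vertex-faddeev-pair-sector`, stub S6
`stub_mourreThresholdLAP` (Mourre's limiting absorption principle; NOT in the tree). Second half of
step L1 of the proof map, over `…LAPResolventCalculus`: for the resolvent
`R(z) = resolventAt U z = (H - z)⁻¹` through the group at non-real `z`,

* the first resolvent identity `R(z) - R(w) = (z - w) R(z) R(w)` (headline
  `resolventAt_first_resolvent_identity`) and commutativity `R(z) R(w) = R(w) R(z)`;
* the Lipschitz bound `‖R(z) - R(w)‖ ≤ |z - w| / (|Im z| |Im w|)`, continuity and holomorphy
  `d/dz R(z) = R(z)²` on `ℂ ∖ ℝ` in operator norm;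
* the dissipativity identity `‖R(z) f‖² = Im ⟪f, R(z) f⟫ / Im z` and the a-priori bound
  `‖R(z) f‖² ≤ |⟪f, R(z) f⟫| / |Im z|` (the mechanism behind ABG (7.3.4)).
-/

noncomputable section

open MeasureTheory Complex Filter Topology Set
open scoped InnerProductSpace ComplexConjugate SchwartzMap FourierTransform ENNReal NNReal

namespace Summit.AtomisticToContinuum.FouriersLaw.Theorems.MourreDissolution

open Literature.Analysis.UnboundedOperators
open Literature.Analysis.UnboundedOperators.UnitaryRep

variable {H : Type*} [NormedAddCommGroup H] [InnerProductSpace ℂ H] [CompleteSpace H]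

/-! ## §1. The first resolvent identity and its consequences -/

/-- **First resolvent identity**: `R(z) f - R(w) f = (z - w) R(z) R(w) f` for non-real `z, w`
(`g = R(w) f ∈ D(H)`, `(H - w) g = f`, so `R(z) f = R(z)((H - z) g + (z - w) g)
= g + (z - w) R(z) g`). [folklore] -/
theorem resolventAt_sub_apply {z w : ℂ} (hz : z.im ≠ 0) (hw : w.im ≠ 0)
    (U : OneParameterUnitaryGroup H) (f : H) :
    resolventAt U z f - resolventAt U w f = (z - w) • resolventAt U z (resolventAt U w f) := by
  obtain ⟨hg, hHg⟩ := resolventAt_mem_hamiltonian_domain hw U f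
  have key := resolventAt_hamiltonian_sub_of_ne hz U ⟨resolventAt U w f, hg⟩
  rw [hHg] at key
  -- `key : R(z) (f + w R(w) f - z R(w) f) = R(w) f`
  have : f + w • resolventAt U w f - z • resolventAt U w f =
      f - (z - w) • resolventAt U w f := by rw [sub_smul]; abel
  simp only [this, map_sub, map_smul] at key
  -- `key : R(z) f - (z - w) R(z) R(w) f = R(w) f`
  calc resolventAt U z f - resolventAt U w f
      = resolventAt U z f - (resolventAt U z f - (z - w) • resolventAt U z (resolventAt U w f)) := by
        rw [key]
    _ = (z - w) • resolventAt U z (resolventAt U w f) := by abel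

/-- **First resolvent identity** (operator form): `R(z) - R(w) = (z - w) R(z) R(w)`. [folklore] -/
theorem resolventAt_sub {z w : ℂ} (hz : z.im ≠ 0) (hw : w.im ≠ 0) (U : OneParameterUnitaryGroup H) :
    resolventAt U z - resolventAt U w = (z - w) • (resolventAt U z * resolventAt U w) :=
  ContinuousLinearMap.ext fun f => by
    simpa using resolventAt_sub_apply hz hw U f

/-- **Resolvents commute**: `R(z) R(w) = R(w) R(z)`. [folklore] -/
theorem resolventAt_comm {z w : ℂ} (hz : z.im ≠ 0) (hw : w.im ≠ 0) (U : OneParameterUnitaryGroup H) :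
    resolventAt U z * resolventAt U w = resolventAt U w * resolventAt U z := by
  by_cases hzw : z = w
  · rw [hzw]
  have h1 := resolventAt_sub hz hw U
  have h2 := resolventAt_sub hw hz U
  have h3 : (z - w) • (resolventAt U z * resolventAt U w) =
      (z - w) • (resolventAt U w * resolventAt U z) := by
    rw [← h1, ← neg_sub w z, neg_smul, ← h2]
    abel
  exact smul_right_injective _ (sub_ne_zero.2 hzw) h3

/-- **Lipschitz bound**: `‖R(z) - R(w)‖ ≤ |z - w| / (|Im z| |Im w|)`. [folklore] -/
theorem norm_resolventAt_sub_le {z w : ℂ} (hz : z.im ≠ 0) (hw : w.im ≠ 0)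
    (U : OneParameterUnitaryGroup H) :
    ‖resolventAt U z - resolventAt U w‖ ≤ ‖z - w‖ * (|z.im|⁻¹ * |w.im|⁻¹) := by
  rw [resolventAt_sub hz hw U, norm_smul]
  gcongr
  exact (norm_mul_le _ _).trans (mul_le_mul (norm_resolventAt_le_inv_abs hz U)
    (norm_resolventAt_le_inv_abs hw U) (norm_nonneg _) (by positivity))

/-- The non-real numbers form an open set. [folklore] -/
theorem isOpen_im_ne_zero : IsOpen {z : ℂ | z.im ≠ 0} :=
  isOpen_ne_fun Complex.continuous_im continuous_const

/-- **Continuity of the resolvent in `z`** (in operator norm) on `ℂ ∖ ℝ`. [folklore] -/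
theorem continuousAt_resolventAt {z : ℂ} (hz : z.im ≠ 0) (U : OneParameterUnitaryGroup H) :
    ContinuousAt (fun w => resolventAt U w) z := by
  rw [ContinuousAt, tendsto_iff_norm_sub_tendsto_zero]
  -- near `z`, `|Im w| ≥ |Im z|/2`
  have hnear : ∀ᶠ w in 𝓝 z, |z.im| / 2 ≤ |w.im| := by
    have h := (Complex.continuous_im.continuousAt (x := z)).eventually
      (Metric.ball_mem_nhds z.im (half_pos (abs_pos.2 hz)))
    filter_upwards [h] with w hw
    have hw' : dist w.im z.im < |z.im| / 2 := hw
    rw [Real.dist_eq, abs_sub_comm] at hw'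
    have := abs_sub_abs_le_abs_sub z.im w.im
    linarith
  have hbound : ∀ᶠ w in 𝓝 z, ‖resolventAt U w - resolventAt U z‖ ≤
      ‖w - z‖ * ((|z.im| / 2)⁻¹ * |z.im|⁻¹) := by
    filter_upwards [hnear] with w hw
    have hw0 : w.im ≠ 0 := fun h => by
      rw [h, abs_zero] at hw
      have := abs_pos.2 hz
      linarith
    refine (norm_resolventAt_sub_le hw0 hz U).trans ?_
    have h1 : |w.im|⁻¹ ≤ (|z.im| / 2)⁻¹ := inv_anti₀ (half_pos (abs_pos.2 hz)) hw
    gcongr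
  have h0 : Tendsto (fun w : ℂ => ‖w - z‖ * ((|z.im| / 2)⁻¹ * |z.im|⁻¹)) (𝓝 z) (𝓝 0) := by
    have : Tendsto (fun w : ℂ => ‖w - z‖) (𝓝 z) (𝓝 0) := by
      have := tendsto_id (x := 𝓝 z)
      rw [tendsto_iff_norm_sub_tendsto_zero] at this
      exact this
    simpa using this.mul_const ((|z.im| / 2)⁻¹ * |z.im|⁻¹)
  exact squeeze_zero' (Eventually.of_forall fun w => norm_nonneg _) hbound h0

/-- **The resolvent is holomorphic on `ℂ ∖ ℝ` with `d/dz R(z) = R(z)²`**: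
`R(w) - R(z) - (w - z) R(z)² = (w - z)(R(w) - R(z)) R(z)` is `o(w - z)` by continuity. [folklore] -/
theorem hasDerivAt_resolventAt {z : ℂ} (hz : z.im ≠ 0) (U : OneParameterUnitaryGroup H) :
    HasDerivAt (fun w => resolventAt U w) (resolventAt U z * resolventAt U z) z := by
  rw [hasDerivAt_iff_isLittleO]
  have hnear : ∀ᶠ w in 𝓝 z, w.im ≠ 0 := isOpen_im_ne_zero.mem_nhds hz
  -- the remainder is `(w - z) • ((R w - R z) * R z)` near `z`
  have heq : (fun w => (w - z) • ((resolventAt U w - resolventAt U z) * resolventAt U z)) =ᶠ[𝓝 z]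
      fun w => resolventAt U w - resolventAt U z - (w - z) • (resolventAt U z * resolventAt U z) := by
    filter_upwards [hnear] with w hw
    rw [sub_mul, smul_sub, ← resolventAt_sub hw hz U]
  have h1 : (fun w => (resolventAt U w - resolventAt U z) * resolventAt U z) =o[𝓝 z]
      fun _ => (1 : ℂ) := by
    rw [Asymptotics.isLittleO_one_iff]
    have := (((continuousAt_resolventAt hz U).tendsto).sub_const (resolventAt U z)).mul_const
      (resolventAt U z)
    simpa using this
  have h2 : (fun w : ℂ => w - z) =O[𝓝 z] fun w : ℂ => w - z := Asymptotics.isBigO_refl _ _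
  have h3 := h2.smul_isLittleO h1
  simp only [smul_eq_mul, mul_one] at h3
  exact h3.congr' heq Filter.EventuallyEq.rfl

/-- **Dissipativity identity**: `‖R(z) f‖² = Im ⟪f, R(z) f⟫ / Im z` for non-real `z`
(the resolvent identity at `(z̄, z)` and `R(z̄) = R(z)*`: `⟪f, (R(z̄) - R(z)) f⟫ = (z̄ - z)‖R(z) f‖²`;
the a-priori bound behind (7.3.4) of ABG). [folklore] -/
theorem norm_sq_resolventAt_apply {z : ℂ} (hz : z.im ≠ 0) (U : OneParameterUnitaryGroup H) (f : H) :
    ‖resolventAt U z f‖ ^ 2 = (⟪f, resolventAt U z f⟫_ℂ).im / z.im := by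
  have hz' : (conj z).im ≠ 0 := by rw [Complex.conj_im]; exact neg_ne_zero.2 hz
  have h1 := resolventAt_sub_apply hz' hz U f
  have h2 : ⟪f, resolventAt U (conj z) f⟫_ℂ - ⟪f, resolventAt U z f⟫_ℂ =
      (conj z - z) * ⟪resolventAt U z f, resolventAt U z f⟫_ℂ := by
    rw [← inner_sub_right, h1, inner_smul_right, inner_resolventAt_right hz', Complex.conj_conj]
  rw [inner_resolventAt_conj_self hz] at h2
  have h3 := congrArg Complex.im h2
  simp only [Complex.sub_im, Complex.conj_im, Complex.mul_im, Complex.sub_re, Complex.conj_re,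
    sub_self, zero_mul, zero_add] at h3
  have hq : (⟪resolventAt U z f, resolventAt U z f⟫_ℂ).re = ‖resolventAt U z f‖ ^ 2 := by
    rw [← RCLike.re_to_complex, inner_self_eq_norm_sq]
  rw [hq] at h3
  field_simp
  linarith

/-- **A-priori bound**: `‖R(z) f‖² ≤ |⟪f, R(z) f⟫| / |Im z|`. [folklore] -/
theorem norm_sq_resolventAt_apply_le {z : ℂ} (hz : z.im ≠ 0) (U : OneParameterUnitaryGroup H)
    (f : H) : ‖resolventAt U z f‖ ^ 2 ≤ ‖⟪f, resolventAt U z f⟫_ℂ‖ / |z.im| := by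
  rw [norm_sq_resolventAt_apply hz U f]
  calc (⟪f, resolventAt U z f⟫_ℂ).im / z.im ≤ |(⟪f, resolventAt U z f⟫_ℂ).im / z.im| := le_abs_self _
    _ = |(⟪f, resolventAt U z f⟫_ℂ).im| / |z.im| := abs_div _ _
    _ ≤ ‖⟪f, resolventAt U z f⟫_ℂ‖ / |z.im| := by gcongr; exact Complex.abs_im_le_norm _

/-! ## §2. Headline (registered helper stub) -/

/-- **First resolvent identity, headline form** (all binders explicit; registered helper stub of
`stub_mourreThresholdLAP`): `R(z) - R(w) = (z - w) R(z) R(w)` for the resolvent through the group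
at non-real `z, w`. [folklore] -/
theorem resolventAt_first_resolvent_identity :
    ∀ (K : Type) [NormedAddCommGroup K] [InnerProductSpace ℂ K] [CompleteSpace K]
      (U : Literature.Analysis.UnboundedOperators.OneParameterUnitaryGroup K) (z w : ℂ),
      z.im ≠ 0 → w.im ≠ 0 →
        Summit.AtomisticToContinuum.FouriersLaw.Theorems.MourreDissolution.resolventAt U z -
            Summit.AtomisticToContinuum.FouriersLaw.Theorems.MourreDissolution.resolventAt U w =
          (z - w) • (Summit.AtomisticToContinuum.FouriersLaw.Theorems.MourreDissolution.resolventAt U z *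
            Summit.AtomisticToContinuum.FouriersLaw.Theorems.MourreDissolution.resolventAt U w) := by
  intro K _ _ _ U z w hz hw
  exact resolventAt_sub hz hw U

end Summit.AtomisticToContinuum.FouriersLaw.Theorems.MourreDissolution
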